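import Literature.AlgebraicGeometry.Frobenioids.PadicKummerSetting
import HarnessLib

/-!
# Frobenioids II, Theorem 2.4 (ii) / Remark 2.4.2: the logic linking «acts on `F_N` by the `ζ`-th power»,
# compatibility, and incompatibility with the natural invariant isomorphisms

Proof-only companion to `PadicKummerSetting.lean` (abc-iut cell, layer L1; SUBDAG-FrdII-Thm24.md rows
L24 `Assembly_ii` / L26 `UnitwiseFrobeniusWitness` — the LOGIC half only; the witness CONSTRUCTION of
Remark 2.4.2 from the unit-wise Frobenius functor of [FrdI] Prop. 2.9 (ii) stays OPEN there).

S. Mochizuki, *The geometry of Frobenioids II*, Kyushu J. Math. **62** (2008), Theorem 2.4 (ii) p. 20 and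
Remark 2.4.2 p. 22 [cite: MochizukiFrdII2008, Rmk 2.4.2 p.22]: "if the `Φᵢ` fail to be fieldwise saturated,
then it is no longer possible in general to conclude that the isomorphism `F_N(A₁) ⥲ F_N(A₂)` is compatible
with the natural isomorphisms `F_N(Aᵢ) ⥲ ℤ/Nℤ` … an example of such a `Ψ` is provided by the unit-wise
Frobenius functor of [FrdI], Proposition 2.9, (ii), which acts on `F_N(Aᵢ)` [relative to the natural
isomorphisms `F_N(Aᵢ) ⥲ ℤ/Nℤ`] by raising to the `ζ`-th power." Over abc-iut-L1-t7's typed predicates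
(`Thm24Data`, `FNInvariant`, `Thm24ii`, `InvariantIncompatible`, `ActsOnFNByPower`):

* `actsOnFNByPower_one_iff` — acting by the `1`-st power IS compatibility with the invariant isomorphisms;
* `thm24ii_of_actsOnFNByPower_one` — hence it yields Theorem 2.4 (ii)'s conclusion (for any `fsᵢ`);
* `invariantIncompatible_of_actsOnFNByPower` — acting by the `ζ`-th power with `ζ ≠ 1` (in `ℤ/Nℤ`) gives
  `InvariantIncompatible` (witness: the element of `F_N(A₁)` with invariant `1`); this is exactly the
  inference print draws from the unit-wise Frobenius functor;
* `not_thm24ii_conclusion_of_invariantIncompatible` — and then the compatibility of Thm. 2.4 (ii) fails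
  (so, as print says, fieldwise saturation cannot be dropped).

Nothing here constructs the unit-wise Frobenius functor or asserts that a given `Ψ` acts by a power; no
side is taken on anything in [IUTchIII]; typed ≠ proved for the open half.
-/

namespace Literature.AlgebraicGeometry.Frobenioids

namespace PadicKummer

variable {X₁ X₂ : Def22Context} {N : ℕ}

/-- Acting on `F_N` by the FIRST power, relative to the natural invariant isomorphisms, is the same as
being compatible with them ([FrdII] Thm. 2.4 (ii) p. 20 / Rmk. 2.4.2 p. 22 with `ζ = 1`).
[cite: MochizukiFrdII2008, Rmk 2.4.2 p.22] -/
theorem actsOnFNByPower_one_iff (T : Thm24Data X₁ X₂ N) (inv₁ : FNInvariant X₁ N)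
    (inv₂ : FNInvariant X₂ N) :
    ActsOnFNByPower X₁ X₂ N T inv₁ inv₂ 1 ↔ ∀ x : FN X₁ N, inv₂.toAddEquiv (T.isoFN x) = inv₁.toAddEquiv x := by
  unfold ActsOnFNByPower
  simp only [one_mul]

/-- If `Ψ` acts on `F_N` by the first power then the conclusion of Theorem 2.4 (ii) holds (whatever the
fieldwise-saturation propositions `fsᵢ` are). [cite: MochizukiFrdII2008, Thm 2.4 (ii) p.20] -/
theorem thm24ii_of_actsOnFNByPower_one (fs₁ fs₂ : Prop) (T : Thm24Data X₁ X₂ N)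
    (inv₁ : FNInvariant X₁ N) (inv₂ : FNInvariant X₂ N) (h : ActsOnFNByPower X₁ X₂ N T inv₁ inv₂ 1) :
    Thm24ii X₁ X₂ N fs₁ fs₂ T inv₁ inv₂ :=
  fun _ _ x => (actsOnFNByPower_one_iff T inv₁ inv₂).mp h x

/-- **Remark 2.4.2, the inference** (p. 22): a `Ψ` that acts on `F_N(Aᵢ)`, relative to the natural
isomorphisms `F_N(Aᵢ) ⥲ ℤ/Nℤ`, by raising to the `ζ`-th power with `ζ ≠ 1` in `ℤ/Nℤ` is NOT compatible with
those isomorphisms: the class with invariant `1 ∈ ℤ/Nℤ` is moved to the class with invariant `ζ`.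
[cite: MochizukiFrdII2008, Rmk 2.4.2 p.22] -/
theorem invariantIncompatible_of_actsOnFNByPower (T : Thm24Data X₁ X₂ N) (inv₁ : FNInvariant X₁ N)
    (inv₂ : FNInvariant X₂ N) {ζ : ZMod N} (hζ : ζ ≠ 1)
    (h : ActsOnFNByPower X₁ X₂ N T inv₁ inv₂ ζ) : InvariantIncompatible X₁ X₂ N T inv₁ inv₂ := by
  refine ⟨inv₁.toAddEquiv.symm 1, ?_⟩
  rw [h, AddEquiv.apply_symm_apply, mul_one]
  exact hζ

/-- Incompatibility with the invariant isomorphisms refutes the conclusion of Theorem 2.4 (ii) for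
fieldwise-saturated `Φᵢ` — print's point that (ii) needs the saturation hypothesis ([FrdII] Rmk. 2.4.2:
"it is no longer possible in general to conclude …"). [cite: MochizukiFrdII2008, Rmk 2.4.2 p.22] -/
theorem not_thm24ii_conclusion_of_invariantIncompatible (T : Thm24Data X₁ X₂ N)
    (inv₁ : FNInvariant X₁ N) (inv₂ : FNInvariant X₂ N)
    (h : InvariantIncompatible X₁ X₂ N T inv₁ inv₂) :
    ¬ ∀ x : FN X₁ N, inv₂.toAddEquiv (T.isoFN x) = inv₁.toAddEquiv x := by
  obtain ⟨x, hx⟩ := h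
  exact fun hall => hx (hall x)

/-- In particular `Thm24ii … fs₁ fs₂ …` together with `fs₁`, `fs₂` is inconsistent with
`InvariantIncompatible`: a `Ψ` witnessing Remark 2.4.2 lives over NON-fieldwise-saturated `Φᵢ`.
[cite: MochizukiFrdII2008, Rmk 2.4.2 p.22] -/
theorem not_invariantIncompatible_of_thm24ii {fs₁ fs₂ : Prop} (T : Thm24Data X₁ X₂ N)
    (inv₁ : FNInvariant X₁ N) (inv₂ : FNInvariant X₂ N)
    (h : Thm24ii X₁ X₂ N fs₁ fs₂ T inv₁ inv₂) (h₁ : fs₁) (h₂ : fs₂) :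
    ¬ InvariantIncompatible X₁ X₂ N T inv₁ inv₂ := fun hinc =>
  not_thm24ii_conclusion_of_invariantIncompatible T inv₁ inv₂ hinc (h h₁ h₂)

/-- Acting by two powers `ζ`, `ζ'` at once forces `ζ = ζ'` as soon as `F_N` is inhabited by a class of
invariant `1` — the power in Remark 2.4.2 is well defined. [cite: MochizukiFrdII2008, Rmk 2.4.2 p.22] -/
theorem actsOnFNByPower_unique (T : Thm24Data X₁ X₂ N) (inv₁ : FNInvariant X₁ N)
    (inv₂ : FNInvariant X₂ N) {ζ ζ' : ZMod N} (h : ActsOnFNByPower X₁ X₂ N T inv₁ inv₂ ζ)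
    (h' : ActsOnFNByPower X₁ X₂ N T inv₁ inv₂ ζ') : ζ = ζ' := by
  have h1 := h (inv₁.toAddEquiv.symm 1)
  have h2 := h' (inv₁.toAddEquiv.symm 1)
  rw [AddEquiv.apply_symm_apply, mul_one] at h1 h2
  exact h1.symm.trans h2

end PadicKummer

end Literature.AlgebraicGeometry.Frobenioids
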